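import Summits.NavierStokesRegularity.NavierStokesRegularity.Theorems.RellichScarSymmetricScarExistsApexLerayProfileLemmas
import Literature.Analysis.FluidPDE.LocalTypeICongr

/-!
# Crux `SymmetricScarExists` (stmt-NavierStokesRegularity-11718), line `logtime-bernoulli-certificate`:
# STUB 1 (`stub_apexLerayProfile`) from the scale-invariant regularity of apex profiles
# (registered sub-goal `stub_apexLerayProfile_ofRegularity`)

Helper file (`--supports stmt-NavierStokesRegularity-11718`; theorems only, no definitions, no named
facts).  The registered stub `stub_apexLerayProfile` of the line's skeleton
(`Cruxes/SymmetricScarExists/Lines/logtime-bernoulli-certificate.lean`) packages a singular APEX PROFILE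
— `(u, p)` suitable weak Navier–Stokes (`ν = 1`, `f = 0`) on the slab `(−∞,0) × ℝ³`, weak spatial
gradient `G`, Albritton–Barker quantity `𝐈(ℝ³ × ℝ₋) < ∞` (`typeIBound (Iio 0 ×ˢ univ) u p G < ⊤`), the
Type-I bound `‖u(t,x)‖ ≤ C/(‖x‖+√(−t))` (`HasTypeIDecay C u`), a backward-singular origin — as a SMOOTH
eternal backward-Leray profile `(U, P)` with eight weighted bounds, physical field `ofLerayOrbit U = u`
a.e. on the slab, origin still singular.  That is XL known mathematics (Koch–Nadirashvili–Seregin–Šverák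
2009 §§3–4, Seregin–Šverák 2009 §2, Albritton–Barker 2019 §3); this file isolates the analytic input
as ONE hypothesis in physical variables and proves the rest:

* `stub_apexLerayProfile_ofRegularity` (registered sub-goal) — STUB 1 follows from the
  **scale-invariant parabolic regularity of apex profiles**: every apex profile agrees a.e. on the
  slab with a classical solution `(v, q)` on `(−∞, 0)` obeying `(‖x‖+√(−t))^{1+k}‖∇ᵏv‖ ≤ K`
  (`k = 1, 2`), `(‖x‖+√(−t))²|q| ≤ K`, `(‖x‖+√(−t))³‖∇q‖ ≤ K`, `(‖x‖+√(−t))³‖∂ₜv‖ ≤ K`,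
  `(‖x‖+√(−t))⁴‖∇∂ₜv‖ ≤ K`.  Proof: the continuous representative inherits the pointwise Type-I bound
  (`norm_le_of_ae_eq_of_continuousOn`); the dictionary `stub_apexLerayProfile_dictionary` of the companion
  file gives the smooth eternal Leray profile `U = lerayOrbit v`, `P = lerayOrbitPressure q` with the
  eight bounds (velocity constant the SAME `C`, the rest `K' = K + K/2 + K + C`);
  `ofLerayOrbit (lerayOrbit v) = v` on `t < 0` and `IsBackwardSingularPoint.congr_ae` transfer the
  a.e. identity and the singular origin.
* `apexLerayProfile_of_representative_of_bounds (hRep) (hBd)` — the same from the two printed halves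
  separately: (hRep) an apex profile has a CLASSICAL REPRESENTATIVE on `(−∞,0)` (KNSS 2009 Lemma 3.1:
  bounded weak = drift-mild + parasitic `b(t)` — tree `KNSS2009_weak_driftMild_holds` — the decay
  `‖u‖ ≤ C/‖x‖` forcing `b` constant on each window; Prop. 4.1 / (4.10)–(4.11): bounded mild solutions
  are smooth — tree `knss2009_smoothing_holds`, `classical_of_smooth_isMildNSSolutionOn_holds`; glue the
  windows `t < −δ`, pressures normalised at `x = 0`); (hBd) a classical Type-I solution on the past is
  classical with SOME pressure — the Riesz pressure `Q[v] = RᵢRⱼ(vᵢvⱼ)`, `∇q = ∇Q[v(t)]` by the tree's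
  `PineauVicol2026.gradient_pressure_eq_of_typeI` — obeying the six SCALE-INVARIANT BOUNDS
  (Seregin–Šverák 2009 §2 p. 8, interior regularity with the dependence of the norms — tree
  `NSBoundedHigherRegularityBounds_holds` — at unit scale after the Navier–Stokes rescaling, plus
  Calderón–Zygmund estimates for `Q[v]`; not in the tree).

What is NOT here: the discharge of these hypotheses (no `sorry`: they are antecedents).  The tree's
named fact `AlbrittonBarkerForward` (A–B 2019 Thm 1.1, forward half) is of no use for this stub: it
yields SOME mild bounded ancient solution by blow-up, not a representative of the given `u`.

## References

* G. Koch, N. Nadirashvili, G. Seregin, V. Šverák, Acta Math. 203 (2009) = arXiv:0709.3599,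
  Lemma 3.1, §4. [KochNadirashviliSereginSverak2009]
* G. Seregin, V. Šverák, Comm. PDE 34 (2009) = arXiv:0804.1803, §2 p. 8. [SereginSverak2009]
* D. Albritton, T. Barker, J. Math. Fluid Mech. 21 (2019) = arXiv:1811.00502, §3. [AlbrittonBarker2019]
* B. Pineau, V. Vicol, arXiv:2607.09619 (2026), Lemma 2.1. [PineauVicol2026]
* D. Chae, J. Wolf, Comm. PDE 42 (2017) = arXiv:1610.09464, §4. [ChaeWolf2017RemovingDSS]
-/

noncomputable section

open MeasureTheory Set Function Filter Topology

namespace Summit.NavierStokesRegularity.NavierStokesRegularity.Theorems.SymmetricScarExists.LogtimeBernoulli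

open Literature.Analysis.FluidPDE

/-! ### Continuous representatives inherit pointwise bounds -/

/-- **A continuous representative inherits a pointwise bound.** If `v = u` a.e. on an open set `S`,
`v` and the majorant `g` are continuous on `S`, and `‖u‖ ≤ g` everywhere on `S`, then `‖v‖ ≤ g`
everywhere on `S` (the excess `(‖v‖ − g)⁺` is continuous and a.e. zero on the open set `S`).
[folklore] -/
theorem norm_le_of_ae_eq_of_continuousOn {v u : ℝ × (EuclideanSpace ℝ (Fin 3)) → (EuclideanSpace ℝ (Fin 3))}
    {g : ℝ × (EuclideanSpace ℝ (Fin 3)) → ℝ} {S : Set (ℝ × (EuclideanSpace ℝ (Fin 3)))}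
    (hS : IsOpen S) (hv : ContinuousOn v S) (hg : ContinuousOn g S)
    (hae : v =ᵐ[volume.restrict S] u) (hu : ∀ z ∈ S, ‖u z‖ ≤ g z) : ∀ z ∈ S, ‖v z‖ ≤ g z := by
  have h1 : (fun z => max (‖v z‖ - g z) 0) =ᵐ[volume.restrict S] fun _ => (0 : ℝ) := by
    filter_upwards [hae, ae_restrict_mem hS.measurableSet] with z hz hzS
    rw [hz, max_eq_right]
    linarith [hu z hzS]
  have h2 : EqOn (fun z => max (‖v z‖ - g z) 0) (fun _ => (0 : ℝ)) S :=
    Measure.eqOn_open_of_ae_eq h1 hS ((hv.norm.sub hg).sup continuousOn_const) continuousOn_const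
  intro z hz
  have h3 : max (‖v z‖ - g z) 0 = 0 := h2 hz
  linarith [le_max_left (‖v z‖ - g z) 0]

/-- The continuous velocity of a classical solution on the past which agrees a.e. on the slab with a
field obeying the Type-I bound `‖u(t,x)‖ ≤ C/(‖x‖+√(−t))` obeys it too, with the SAME constant.
[folklore] -/
theorem hasTypeIDecay_of_ae_eq {u v : ℝ → (EuclideanSpace ℝ (Fin 3)) → (EuclideanSpace ℝ (Fin 3))} {q : ℝ → (EuclideanSpace ℝ (Fin 3)) → ℝ} {C : ℝ}
    (hcl : IsClassicalNSSolutionOn (Iio 0) 1 0 v q)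
    (hae : uncurry v =ᵐ[volume.restrict (Iio (0 : ℝ) ×ˢ (univ : Set (EuclideanSpace ℝ (Fin 3))))] uncurry u)
    (hdecu : HasTypeIDecay C u) : HasTypeIDecay C v := by
  have hg : ContinuousOn (fun z : ℝ × (EuclideanSpace ℝ (Fin 3)) => C / (‖z.2‖ + Real.sqrt (-z.1)))
      (Iio (0 : ℝ) ×ˢ (univ : Set (EuclideanSpace ℝ (Fin 3)))) := by
    refine continuousOn_const.div ?_ fun z hz => ?_
    · exact ((continuous_norm.comp continuous_snd).add
        (Real.continuous_sqrt.comp (continuous_neg.comp continuous_fst))).continuousOn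
    · exact (add_pos_of_nonneg_of_pos (norm_nonneg _) (Real.sqrt_pos.2 (neg_pos.2 hz.1))).ne'
  have key := norm_le_of_ae_eq_of_continuousOn (isOpen_Iio.prod isOpen_univ)
    hcl.smooth_velocity.continuousOn hg hae (fun z hz => hdecu z.1 hz.1 z.2)
  exact fun t ht x => key (t, x) ⟨ht, mem_univ _⟩

/-! ### STUB 1 from the scale-invariant regularity of apex profiles (registered sub-goal) -/

/-- **Registered sub-goal `stub_apexLerayProfile_ofRegularity` of STUB 1.**  ANTECEDENT (known
mathematics, not yet in the tree under one name): every suitable weak solution of Navier–Stokes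
(`ν = 1`, `f = 0`) on the slab `(−∞,0) × ℝ³` with a weak spatial gradient, `𝐈(ℝ³ × ℝ₋) < ∞` and the
Type-I bound `‖u(t,x)‖ ≤ C/(‖x‖ + √(−t))` agrees a.e. on the slab with a CLASSICAL solution `(v, q)` on
`(−∞, 0)` (Koch–Nadirashvili–Seregin–Šverák 2009, Lemma 3.1 and Prop. 4.1: bounded weak = mild +
parasitic drift, the drift being killed by the spatial decay; bounded mild solutions are smooth; `q`
the Riesz pressure `RᵢRⱼ(vᵢvⱼ)`) obeying the scale-invariant bounds
`(‖x‖+√(−t))^{1+k}‖∇ᵏv‖ ≤ K` (`k = 1, 2`), `(‖x‖+√(−t))²|q| ≤ K`, `(‖x‖+√(−t))³‖∇q‖ ≤ K`,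
`(‖x‖+√(−t))³‖∂ₜv‖ ≤ K`, `(‖x‖+√(−t))⁴‖∇∂ₜv‖ ≤ K` (Seregin–Šverák 2009 §2: interior regularity of
bounded solutions with the dependence of the norms, at unit scale after rescaling; Calderón–Zygmund
bounds for the Riesz pressure).  CONSEQUENT: the registered signature of `stub_apexLerayProfile`
verbatim (`U = lerayOrbit v`, `P = lerayOrbitPressure q`, `K' = K + K/2 + K + C`; dictionary
`stub_apexLerayProfile_dictionary`, `hasTypeIDecay_of_ae_eq`, `ofLerayOrbit_lerayOrbit`,
`IsBackwardSingularPoint.congr_ae`).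
[cite: KochNadirashviliSereginSverak2009, Lemma 3.1 p. 7 and §4 (4.10)–(4.11) p. 8 (arXiv:0709.3599)] -/
theorem stub_apexLerayProfile_ofRegularity :
    (∀ (u : ℝ → EuclideanSpace ℝ (Fin 3) → EuclideanSpace ℝ (Fin 3)) (p : ℝ → EuclideanSpace ℝ (Fin 3) → ℝ) (G : ℝ → EuclideanSpace ℝ (Fin 3) → EuclideanSpace ℝ (Fin 3) →L[ℝ] EuclideanSpace ℝ (Fin 3)) (C : ℝ), Literature.Analysis.FluidPDE.IsSuitableWeakSolutionOn (Literature.Analysis.FluidPDE.slab (EuclideanSpace ℝ (Fin 3)) (Set.Iio 0) isOpen_Iio) 1 0 u p → Literature.Analysis.FluidPDE.HasWeakSpatialGradientOn (Literature.Analysis.FluidPDE.slab (EuclideanSpace ℝ (Fin 3)) (Set.Iio 0) isOpen_Iio) u G → Literature.Analysis.FluidPDE.typeIBound (Set.Iio (0 : ℝ) ×ˢ Set.univ) u p G < ⊤ → Literature.Analysis.FluidPDE.HasTypeIDecay C u → ∃ (v : ℝ → EuclideanSpace ℝ (Fin 3) → EuclideanSpace ℝ (Fin 3)) (q : ℝ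 → EuclideanSpace ℝ (Fin 3) → ℝ) (K : ℝ), Literature.Analysis.FluidPDE.IsClassicalNSSolutionOn (Set.Iio 0) 1 0 v q ∧ Function.uncurry v =ᵐ[MeasureTheory.volume.restrict (Set.Iio (0 : ℝ) ×ˢ (Set.univ : Set (EuclideanSpace ℝ (Fin 3))))] Function.uncurry u ∧ ∀ t < (0 : ℝ), ∀ (x : EuclideanSpace ℝ (Fin 3)), (‖x‖ + Real.sqrt (-t)) ^ 2 * ‖fderiv ℝ (v t) x‖ ≤ K ∧ (‖x‖ + Real.sqrt (-t)) ^ 3 * ‖iteratedFDeriv ℝ 2 (v t) x‖ ≤ K ∧ (‖x‖ + Real.sqrt (-t)) ^ 2 * |q t x| ≤ K ∧ (‖x‖ + Real.sqrt (-t)) ^ 3 * ‖gradient (q t) x‖ ≤ K ∧ (‖x‖ + Real.sqrt (-t)) ^ 3 * ‖Literature.Analysis.FluidPDE.timeDeriv v t x‖ ≤ K ∧ (‖x‖ + Real.sqrt (-t)) ^ 4 * ‖fderiv ℝ (Literature.Analysis.FluidPDE.timeDeriv v t) x‖ ≤ K) → ∀ (u : ℝ → EuclideanSpace ℝ (Fin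 3) → EuclideanSpace ℝ (Fin 3)) (p : ℝ → EuclideanSpace ℝ (Fin 3) → ℝ) (G : ℝ → EuclideanSpace ℝ (Fin 3) → EuclideanSpace ℝ (Fin 3) →L[ℝ] EuclideanSpace ℝ (Fin 3)) (C : ℝ), Literature.Analysis.FluidPDE.IsSuitableWeakSolutionOn (Literature.Analysis.FluidPDE.slab (EuclideanSpace ℝ (Fin 3)) (Set.Iio 0) isOpen_Iio) 1 0 u p → Literature.Analysis.FluidPDE.HasWeakSpatialGradientOn (Literature.Analysis.FluidPDE.slab (EuclideanSpace ℝ (Fin 3)) (Set.Iio 0) isOpen_Iio) u G → Literature.Analysis.FluidPDE.typeIBound (Set.Iio (0 : ℝ) ×ˢ Set.univ) u p G < ⊤ → Literature.Analysis.FluidPDE.HasTypeIDecay C u → Literature.Analysis.FluidPDE.IsBackwardSingularPoint u 0 → ∃ (U : ℝ → EuclideanSpace ℝ (Fin 3) → EuclideanSpace ℝ (Fin 3)) (P : ℝ → EuclideanSpace ℝ (Fin 3) → ℝ) (K : ℝ), (Literature.Analysis.FluidPDE.IsBackwardLeraySolutionOn (Set.univ : Set ℝ) 1 U P ∧ ∀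 (s : ℝ) (y : EuclideanSpace ℝ (Fin 3)), (1 + ‖y‖) * ‖U s y‖ ≤ C ∧ (1 + ‖y‖) ^ 2 * ‖fderiv ℝ (U s) y‖ ≤ K ∧ (1 + ‖y‖) ^ 3 * ‖iteratedFDeriv ℝ 2 (U s) y‖ ≤ K ∧ (1 + ‖y‖) ^ 2 * |P s y| ≤ K ∧ (1 + ‖y‖) ^ 3 * ‖gradient (P s) y‖ ≤ K ∧ (1 + ‖y‖) * ‖Literature.Analysis.FluidPDE.timeDerivWithin (Set.univ : Set ℝ) U s y‖ ≤ K ∧ (1 + ‖y‖) ^ 2 * ‖fderiv ℝ (fun z => Literature.Analysis.FluidPDE.timeDerivWithin (Set.univ : Set ℝ) U s z) y‖ ≤ K ∧ (1 + ‖y‖) ^ 3 * ‖Literature.Analysis.FluidPDE.timeDerivWithin (Set.univ : Set ℝ) U s y + (1 / 2 : ℝ) • U s y + (1 / 2 : ℝ) • fderiv ℝ (U s) y y‖ ≤ K) ∧ (Function.uncurry (Literature.Analysis.FluidPDE.ofLerayOrbit U) =ᵐ[MeasureTheory.volume.restrict (Set.Iio (0 : ℝ) ×ˢ (Set.univ :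 Set (EuclideanSpace ℝ (Fin 3))))] Function.uncurry u) ∧ Literature.Analysis.FluidPDE.IsBackwardSingularPoint (Literature.Analysis.FluidPDE.ofLerayOrbit U) 0 := by
  intro hReg u p G C hsw hwg hI hdecu hsing
  obtain ⟨v, q, K, hcl, hae, hb⟩ := hReg u p G C hsw hwg hI hdecu
  have hdecv : HasTypeIDecay C v := hasTypeIDecay_of_ae_eq hcl hae hdecu
  -- the a.e. identification on the slab
  have hae' : uncurry (ofLerayOrbit (lerayOrbit v)) =ᵐ[volume.restrict
      (Iio (0 : ℝ) ×ˢ (univ : Set (EuclideanSpace ℝ (Fin 3))))] uncurry u := by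
    refine EventuallyEq.trans ?_ hae
    filter_upwards [ae_restrict_mem (measurableSet_Iio.prod MeasurableSet.univ)] with z hz
    exact ofLerayOrbit_lerayOrbit v hz.1 z.2
  exact ⟨lerayOrbit v, lerayOrbitPressure q, K + K / 2 + K + C,
    stub_apexLerayProfile_dictionary v q C K hcl hdecv hb, hae',
    hsing.congr_ae (fun r _ => parabolicCylinder_origin_subset_slab r) hae'.symm⟩

/-- **STUB 1 from the two printed regularity facts separately** (the intended discharge path of the
antecedent of `stub_apexLerayProfile_ofRegularity`): (hRep) an apex suitable weak profile agrees a.e. on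
the slab with a classical solution `(v, q)` on `(−∞, 0)` (KNSS 2009, Lemma 3.1 + Prop. 4.1, the
parasitic drift being constant by the spatial decay; Albritton–Barker 2019 §3); (hBd) a classical
solution on `(−∞, 0)` with the Type-I bound is classical with SOME pressure `q'` (the Riesz pressure:
Tao 2013 Lemma 4.1, Pineau–Vicol 2026 Lemma 2.1, tree `PineauVicol2026.gradient_pressure_eq_of_typeI`)
obeying, with `v`, the six scale-invariant bounds (Seregin–Šverák 2009 §2 p. 8 at unit scale after
rescaling, tree `NSBoundedHigherRegularityBounds_holds`; Calderón–Zygmund bounds for `Q[v]`).  The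
continuous representative inherits the Type-I bound (`hasTypeIDecay_of_ae_eq`), so `hRep ∧ hBd` give
the antecedent. [cite: KochNadirashviliSereginSverak2009, Lemma 3.1 p. 7 and §4 p. 8 (arXiv:0709.3599)] -/
theorem apexLerayProfile_of_representative_of_bounds
    (hRep : ∀ (u : ℝ → (EuclideanSpace ℝ (Fin 3)) → (EuclideanSpace ℝ (Fin 3))) (p : ℝ → (EuclideanSpace ℝ (Fin 3)) → ℝ)
      (G : ℝ → (EuclideanSpace ℝ (Fin 3)) → (EuclideanSpace ℝ (Fin 3)) →L[ℝ] (EuclideanSpace ℝ (Fin 3))) (C : ℝ),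
      IsSuitableWeakSolutionOn (slab (EuclideanSpace ℝ (Fin 3)) (Iio 0) isOpen_Iio) 1 0 u p →
      HasWeakSpatialGradientOn (slab (EuclideanSpace ℝ (Fin 3)) (Iio 0) isOpen_Iio) u G →
      typeIBound (Iio (0 : ℝ) ×ˢ univ) u p G < ⊤ →
      HasTypeIDecay C u →
      ∃ (v : ℝ → (EuclideanSpace ℝ (Fin 3)) → (EuclideanSpace ℝ (Fin 3))) (q : ℝ → (EuclideanSpace ℝ (Fin 3)) → ℝ),
        IsClassicalNSSolutionOn (Iio 0) 1 0 v q ∧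
        uncurry v =ᵐ[volume.restrict (Iio (0 : ℝ) ×ˢ (univ : Set (EuclideanSpace ℝ (Fin 3))))] uncurry u)
    (hBd : ∀ (v : ℝ → (EuclideanSpace ℝ (Fin 3)) → (EuclideanSpace ℝ (Fin 3))) (q : ℝ → (EuclideanSpace ℝ (Fin 3)) → ℝ) (C : ℝ),
      IsClassicalNSSolutionOn (Iio 0) 1 0 v q → HasTypeIDecay C v →
      ∃ (q' : ℝ → (EuclideanSpace ℝ (Fin 3)) → ℝ) (K : ℝ),
        IsClassicalNSSolutionOn (Iio 0) 1 0 v q' ∧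
        ∀ t < 0, ∀ x,
          (‖x‖ + Real.sqrt (-t)) ^ 2 * ‖fderiv ℝ (v t) x‖ ≤ K ∧
          (‖x‖ + Real.sqrt (-t)) ^ 3 * ‖iteratedFDeriv ℝ 2 (v t) x‖ ≤ K ∧
          (‖x‖ + Real.sqrt (-t)) ^ 2 * |q' t x| ≤ K ∧
          (‖x‖ + Real.sqrt (-t)) ^ 3 * ‖gradient (q' t) x‖ ≤ K ∧
          (‖x‖ + Real.sqrt (-t)) ^ 3 * ‖timeDeriv v t x‖ ≤ K ∧
          (‖x‖ + Real.sqrt (-t)) ^ 4 * ‖fderiv ℝ (timeDeriv v t) x‖ ≤ K) :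
    ∀ (u : ℝ → EuclideanSpace ℝ (Fin 3) → EuclideanSpace ℝ (Fin 3)) (p : ℝ → EuclideanSpace ℝ (Fin 3) → ℝ) (G : ℝ → EuclideanSpace ℝ (Fin 3) → EuclideanSpace ℝ (Fin 3) →L[ℝ] EuclideanSpace ℝ (Fin 3)) (C : ℝ), Literature.Analysis.FluidPDE.IsSuitableWeakSolutionOn (Literature.Analysis.FluidPDE.slab (EuclideanSpace ℝ (Fin 3)) (Set.Iio 0) isOpen_Iio) 1 0 u p → Literature.Analysis.FluidPDE.HasWeakSpatialGradientOn (Literature.Analysis.FluidPDE.slab (EuclideanSpace ℝ (Fin 3)) (Set.Iio 0) isOpen_Iio) u G → Literature.Analysis.FluidPDE.typeIBound (Set.Iio (0 : ℝ) ×ˢ Set.univ) u p G < ⊤ → Literature.Analysis.FluidPDE.HasTypeIDecay C u → Literature.Analysis.FluidPDE.IsBackwardSingularPoint u 0 → ∃ (U : ℝ → EuclideanSpace ℝ (Fin 3) → EuclideanSpace ℝ (Fin 3)) (P : ℝ → EuclideanSpace ℝ (Fin 3) → ℝ) (K : ℝ), (Literature.Analysis.FluidPDE.IsBackwardLeraySolutionOn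 (Set.univ : Set ℝ) 1 U P ∧ ∀ (s : ℝ) (y : EuclideanSpace ℝ (Fin 3)), (1 + ‖y‖) * ‖U s y‖ ≤ C ∧ (1 + ‖y‖) ^ 2 * ‖fderiv ℝ (U s) y‖ ≤ K ∧ (1 + ‖y‖) ^ 3 * ‖iteratedFDeriv ℝ 2 (U s) y‖ ≤ K ∧ (1 + ‖y‖) ^ 2 * |P s y| ≤ K ∧ (1 + ‖y‖) ^ 3 * ‖gradient (P s) y‖ ≤ K ∧ (1 + ‖y‖) * ‖Literature.Analysis.FluidPDE.timeDerivWithin (Set.univ : Set ℝ) U s y‖ ≤ K ∧ (1 + ‖y‖) ^ 2 * ‖fderiv ℝ (fun z => Literature.Analysis.FluidPDE.timeDerivWithin (Set.univ : Set ℝ) U s z) y‖ ≤ K ∧ (1 + ‖y‖) ^ 3 * ‖Literature.Analysis.FluidPDE.timeDerivWithin (Set.univ : Set ℝ) U s y + (1 / 2 : ℝ) • U s y + (1 / 2 : ℝ) • fderiv ℝ (U s) y y‖ ≤ K) ∧ (Function.uncurry (Literature.Analysis.FluidPDE.ofLerayOrbit U) =ᵐ[MeasureTheory.volume.restrict (Set.Iio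 (0 : ℝ) ×ˢ (Set.univ : Set (EuclideanSpace ℝ (Fin 3))))] Function.uncurry u) ∧ Literature.Analysis.FluidPDE.IsBackwardSingularPoint (Literature.Analysis.FluidPDE.ofLerayOrbit U) 0 := by
  refine stub_apexLerayProfile_ofRegularity fun u p G C hsw hwg hI hdecu => ?_
  obtain ⟨v, q, hcl, hae⟩ := hRep u p G C hsw hwg hI hdecu
  obtain ⟨q', K, hcl', hb⟩ := hBd v q C hcl (hasTypeIDecay_of_ae_eq hcl hae hdecu)
  exact ⟨v, q', K, hcl', hae, hb⟩

end Summit.NavierStokesRegularity.NavierStokesRegularity.Theorems.SymmetricScarExists.LogtimeBernoulli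

end
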